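import Summits.AtomisticToContinuum.HydrodynamicLimit.Theses.JParityClosure
import Summits.AtomisticToContinuum.HydrodynamicLimit.Theorems.EvenStressEnskog.Negative.PairFunctionalVanishing
import Summits.AtomisticToContinuum.HydrodynamicLimit.Theorems.EvenStressEnskog.Negative.EnskogSideMoments
import Literature.MathematicalPhysics.KineticTheory.TaggedSphereCollisionFrequency

/-!
# Two-stream texture: the Enskog side of `EvenStressEnskog` charges mesoscale velocity oscillations

Negative knowledge for the crux `JParityClosure.EvenStressEnskog` (stmt-AtomisticToContinuum-13079), from the standing
disprover's `Cruxes/EvenStressEnskog/Disproof.lean` §12 (cycle 2). All expressions are VERBATIM the `let`-bodies of the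
crux (`Θ`, `B`, `bx`, `ΞP`).

* `sphereMarkP_trace_pos` — the trace of the sphere-integrated momentum-transfer marks,
  `Σ_k Θ(Ξ_P^{kk})(v,w) = ∫((w−v)·ω)₊² dω`, is STRICTLY POSITIVE for `v ≠ w` (Lorentz loss frequency
  `∫((w−v)·ω)₊ dω = ‖w−v‖·ν(e) > 0` and `∫f² ≥ (∫f)²/|S²|`);
* `pairFunctionalP_two_stream` — if every particle of a configuration has velocity `u₁` or `u₂`, the Enskog pair
  functional of the crux is `B_r(Ξ_P^{kl})(x₀) = 2(N+1)⁻² W₁ W₂ Θ^{kl}(u₁,u₂)` with `W₁ = Σ_{v_i = u₁} b_r(x_i,x₀)`,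
  `W₂ = Σ_{v_i ≠ u₁} b_r(x_i,x₀)`: only CROSS pairs contribute.

Adversarial reading (Disproof §12): on a "two-stream texture" — two families of particles with velocities `u₁ ≠ u₂`,
interleaved at a scale `ℓ` with `ε_N ≪ ℓ ≪ r` and segregated from each other by more than `ε_N` — no intra-family pair
has a relative velocity and no cross pair ever touches, so the collision side `K_N` of the crux is `0` along free
flight, while the Enskog side is the positive quantity above for EVERY `r`: the crux is false surely on such
configurations, by an amount `≍ σ³ Y |u₁ − u₂|²` that does not decrease as `r → 0` once `ℓ = ℓ_N → 0`. Hence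
`EvenStressEnskog` tacitly asserts strong (not merely Young-measure) compactness of the empirical velocity field at
mesoscales — content beyond two-body local equilibrium, invisible to the kinetic contact law; planners are advised to
restrict the crux to `τ < T` (pre-shock), where no texture can form from smooth local-Gibbs profiles.
refuter-cdisprove-stmt-AtomisticToContinuum-13079-g2-0.
-/

noncomputable section

namespace Summit.AtomisticToContinuum.HydrodynamicLimit.Theorems

open MeasureTheory Filter Set
open scoped ENNReal InnerProductSpace
open Literature.MathematicalPhysics.KineticTheory Literature.Analysis.FluidPDE

namespace EvenStressEnskog

/-- Trace of the verbatim sphere-integrated marks: `Σ_k Θ(Ξ_P^{kk})(v,w) = ∫((w−v)·ω)₊² dω`. [folklore] -/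
theorem sphereMarkP_trace_eq (v w : V3) :
    ∑ k : Fin 3, ∫ ω : Metric.sphere (0 : V3) 1, max ⟪w - v, ((ω : V3))⟫_ℝ 0 * ((ω : V3) k * (ω : V3) k) *
        hardSphereKernel (w, v) ω ∂sphereMeasure
      = ∫ ω : Metric.sphere (0 : V3) 1, max ⟪w - v, ((ω : V3))⟫_ℝ 0 ^ 2 ∂sphereMeasure := by
  haveI := Literature.Analysis.FluidPDE.isFiniteMeasure_sphereMeasure (E := V3)
  rw [← integral_finsetSum _ (fun k _ => ?_)]
  · congr 1
    funext ω
    rw [← Finset.sum_mul, ← Finset.mul_sum, hardSphereKernel]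
    have hn : ∑ k : Fin 3, (ω : V3) k * (ω : V3) k = ‖(ω : V3)‖ ^ 2 := by
      rw [EuclideanSpace.real_norm_sq_eq]
      exact Finset.sum_congr rfl fun k _ => by rw [sq]
    rw [hn]
    simp only [norm_eq_of_mem_sphere ω]
    ring
  · have hc : Continuous fun ω : Metric.sphere (0 : V3) 1 =>
        max ⟪w - v, ((ω : V3))⟫_ℝ 0 * ((ω : V3) k * (ω : V3) k) * hardSphereKernel (w, v) ω := by
      unfold hardSphereKernel
      fun_prop
    exact hc.integrable_of_hasCompactSupport (isClosed_tsupport _).isCompact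

/-- Elementary: if `f` and `f²` are integrable for a finite measure and `∫ f > 0` then `∫ f² > 0` (from `(f − c)² ≥ 0` with
`c = ∫f / μ(univ)`). [folklore] -/
theorem integral_sq_pos_of_integral_pos {α : Type*} [MeasurableSpace α] {μ : Measure α}
    [IsFiniteMeasure μ] {f : α → ℝ} (hf : Integrable f μ) (hf2 : Integrable (fun a => f a ^ 2) μ)
    (hpos : 0 < ∫ a, f a ∂μ) : 0 < ∫ a, f a ^ 2 ∂μ := by
  set m : ℝ := μ.real Set.univ with hm
  set I : ℝ := ∫ a, f a ∂μ with hI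
  have key : ∀ c : ℝ, 2 * c * I - c ^ 2 * m ≤ ∫ a, f a ^ 2 ∂μ := by
    intro c
    have h1 : ∫ a, (2 * c * f a - c ^ 2) ∂μ ≤ ∫ a, f a ^ 2 ∂μ := by
      refine integral_mono ((hf.const_mul (2 * c)).sub (integrable_const _)) hf2 fun a => ?_
      nlinarith [sq_nonneg (f a - c)]
    have h2 : ∫ a, (2 * c * f a - c ^ 2) ∂μ = 2 * c * I - c ^ 2 * m := by
      rw [integral_sub (hf.const_mul _) (integrable_const _), integral_const_mul, integral_const,
        smul_eq_mul, hm, hI]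
      ring
    linarith
  by_cases h0 : m = 0
  · have := key 1
    rw [h0, mul_zero, sub_zero] at this
    linarith
  · have hmpos : 0 < m := lt_of_le_of_ne measureReal_nonneg (Ne.symm h0)
    have := key (I / m)
    have e : 2 * (I / m) * I - (I / m) ^ 2 * m = I ^ 2 / m := by
      field_simp
      ring
    rw [e] at this
    exact lt_of_lt_of_le (by positivity) this

/-- **The Enskog side is strictly positive on every pair of distinct velocities**: `0 < Σ_k Θ(Ξ_P^{kk})(v,w)` for `v ≠ w`
(verbatim `Θ`). [folklore] -/
theorem sphereMarkP_trace_pos {v w : V3} (h : v ≠ w) :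
    0 < ∑ k : Fin 3, ∫ ω : Metric.sphere (0 : V3) 1, max ⟪w - v, ((ω : V3))⟫_ℝ 0 * ((ω : V3) k * (ω : V3) k) *
        hardSphereKernel (w, v) ω ∂sphereMeasure := by
  rw [sphereMarkP_trace_eq]
  haveI := Literature.Analysis.FluidPDE.isFiniteMeasure_sphereMeasure (E := V3)
  have hc : Continuous fun ω : Metric.sphere (0 : V3) 1 => max ⟪w - v, ((ω : V3))⟫_ℝ 0 := by
    fun_prop
  have hf : Integrable (fun ω : Metric.sphere (0 : V3) 1 => max ⟪w - v, ((ω : V3))⟫_ℝ 0)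
      sphereMeasure := hc.integrable_of_hasCompactSupport (isClosed_tsupport _).isCompact
  have hf2 : Integrable (fun ω : Metric.sphere (0 : V3) 1 => max ⟪w - v, ((ω : V3))⟫_ℝ 0 ^ 2)
      sphereMeasure := (hc.pow 2).integrable_of_hasCompactSupport (isClosed_tsupport _).isCompact
  refine integral_sq_pos_of_integral_pos hf hf2 ?_
  have hne : w - v ≠ 0 := sub_ne_zero.mpr (Ne.symm h)
  have hnorm : 0 < ‖w - v‖ := norm_pos_iff.mpr hne
  set e : V3 := ‖w - v‖⁻¹ • (w - v) with he
  have heu : ‖e‖ = 1 := by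
    rw [he, norm_smul, norm_inv, norm_norm, inv_mul_cancel₀ hnorm.ne']
  show 0 < lorentzLossRate (w - v)
  rw [lorentzLossRate_eq_norm_mul heu (w - v)]
  exact mul_pos hnorm (lorentzLossRate_pos (by simp) heu)

/-- **Two-stream evaluation of the Enskog pair functional of the crux** (verbatim `B (ΞP k l)` at a fixed configuration).
If every particle has velocity `u₁` or `u₂`, then
`B_r(Ξ_P^{kl})(x₀) = (N+1)⁻² · 2 W₁ W₂ Θ^{kl}(u₁,u₂)`, `W₁ = Σ_{v_i = u₁} b_r(x_i,x₀)`, `W₂ = Σ_{v_i ≠ u₁} b_r(x_i,x₀)`: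
intra-family pairs contribute nothing (`Θ(u,u) = 0`), cross pairs symmetrically. [folklore] -/
theorem pairFunctionalP_two_stream {N : ℕ} (k l : Fin 3) (r : ℝ) (z : Config (N + 1) (Fin 3) T3) (x₀ : T3)
    (u₁ u₂ : V3) (hv : ∀ i, (z i).2 = u₁ ∨ (z i).2 = u₂) :
    ∫ p, 3 / (Real.pi * r ^ 3) * max (1 - Torus.euclidDist p.1.1 x₀ / r) 0 *
        (3 / (Real.pi * r ^ 3) * max (1 - Torus.euclidDist p.2.1 x₀ / r) 0) *
        ∫ ω : Metric.sphere (0 : V3) 1, max ⟪p.2.2 - p.1.2, ((ω : V3))⟫_ℝ 0 * ((ω : V3) k * (ω : V3) l) *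
          hardSphereKernel (p.2.2, p.1.2) ω ∂sphereMeasure
      ∂((empiricalMeasure z).prod (empiricalMeasure z))
    = ((N + 1 : ℕ) : ℝ)⁻¹ * ((N + 1 : ℕ) : ℝ)⁻¹ *
      (2 * ((∑ i ∈ Finset.univ.filter (fun i => (z i).2 = u₁),
              3 / (Real.pi * r ^ 3) * max (1 - Torus.euclidDist (z i).1 x₀ / r) 0) *
        (∑ i ∈ Finset.univ.filter (fun i => ¬ (z i).2 = u₁),
              3 / (Real.pi * r ^ 3) * max (1 - Torus.euclidDist (z i).1 x₀ / r) 0) *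
        ∫ ω : Metric.sphere (0 : V3) 1, max ⟪u₂ - u₁, ((ω : V3))⟫_ℝ 0 * ((ω : V3) k * (ω : V3) l) *
          hardSphereKernel (u₂, u₁) ω ∂sphereMeasure)) := by
  rw [integral_prod_empiricalMeasure]
  congr 1
  simp only
  classical
  set b : Fin (N + 1) → ℝ := fun i => 3 / (Real.pi * r ^ 3) * max (1 - Torus.euclidDist (z i).1 x₀ / r) 0 with hb
  set Θf : V3 → V3 → ℝ := fun v w => ∫ ω : Metric.sphere (0 : V3) 1,
      max ⟪w - v, ((ω : V3))⟫_ℝ 0 * ((ω : V3) k * (ω : V3) l) * hardSphereKernel (w, v) ω ∂sphereMeasure with hΘ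
  have hself : ∀ u : V3, Θf u u = 0 := fun u => by
    simp [hΘ, hardSphereKernel]
  have hsymm : Θf u₂ u₁ = Θf u₁ u₂ := by
    simp only [hΘ]
    exact sphereMarkP_symm k l u₁ u₂
  show ∑ i, ∑ j, b i * b j * Θf (z i).2 (z j).2 = 2 * ((∑ i ∈ Finset.univ.filter (fun i => (z i).2 = u₁), b i) *
      (∑ i ∈ Finset.univ.filter (fun i => ¬ (z i).2 = u₁), b i) * Θf u₁ u₂)
  set A := Finset.univ.filter (fun i : Fin (N + 1) => (z i).2 = u₁) with hA
  set B := Finset.univ.filter (fun i : Fin (N + 1) => ¬ (z i).2 = u₁) with hB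
  have hu2 : ∀ i ∈ B, (z i).2 = u₂ := by
    intro i hi
    rw [hB, Finset.mem_filter] at hi
    rcases hv i with h | h
    · exact absurd h hi.2
    · exact h
  have hu1 : ∀ i ∈ A, (z i).2 = u₁ := fun i hi => by
    rw [hA, Finset.mem_filter] at hi; exact hi.2
  have hsplit : ∀ (f : Fin (N + 1) → ℝ), ∑ i, f i = ∑ i ∈ A, f i + ∑ i ∈ B, f i := by
    intro f
    rw [hA, hB, ← Finset.sum_filter_add_sum_filter_not Finset.univ (fun i => (z i).2 = u₁)]
  rw [hsplit]
  simp_rw [hsplit (fun j => b _ * b j * Θf (z _).2 (z j).2)]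
  have hAA : ∑ i ∈ A, ∑ j ∈ A, b i * b j * Θf (z i).2 (z j).2 = 0 :=
    Finset.sum_eq_zero fun i hi => Finset.sum_eq_zero fun j hj => by
      rw [hu1 i hi, hu1 j hj, hself, mul_zero]
  have hBB : ∑ i ∈ B, ∑ j ∈ B, b i * b j * Θf (z i).2 (z j).2 = 0 :=
    Finset.sum_eq_zero fun i hi => Finset.sum_eq_zero fun j hj => by
      rw [hu2 i hi, hu2 j hj, hself, mul_zero]
  have hAB : ∑ i ∈ A, ∑ j ∈ B, b i * b j * Θf (z i).2 (z j).2 = (∑ i ∈ A, b i) * (∑ j ∈ B, b j) * Θf u₁ u₂ := by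
    rw [Finset.sum_mul_sum, Finset.sum_mul]
    refine Finset.sum_congr rfl fun i hi => ?_
    rw [Finset.sum_mul]
    refine Finset.sum_congr rfl fun j hj => ?_
    rw [hu1 i hi, hu2 j hj]
  have hBA : ∑ i ∈ B, ∑ j ∈ A, b i * b j * Θf (z i).2 (z j).2 = (∑ i ∈ A, b i) * (∑ j ∈ B, b j) * Θf u₁ u₂ := by
    rw [Finset.sum_mul_sum, Finset.sum_mul, Finset.sum_comm]
    refine Finset.sum_congr rfl fun i hi => ?_
    rw [Finset.sum_mul]
    refine Finset.sum_congr rfl fun j hj => ?_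
    rw [hu2 j hj, hu1 i hi, hsymm]
    ring
  simp only [Finset.sum_add_distrib]
  rw [hAA, hBB, hAB, hBA]
  ring

end EvenStressEnskog

end Summit.AtomisticToContinuum.HydrodynamicLimit.Theorems

end
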